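import Summits.QuantumFields.YangMills.Theorems.BalabanLadderIRTwistedSlabSpectralPurity
import HarnessLib

/-!
# Purity propagation from TWO times: the excited weight from an early time `t₁`, the RATE from a late time `t₂`

HELPER toward stub **T1** `TwistedSlabAnchor` of LINE `twisted-slab-continuity` (crux `IRcof`, stmt-QuantumFields-26930, census row 43;
LEAD prover ym-ir-line-tsc-p1 g5; `--supports` the crux, `--as helper`).  Theorems only; Mathlib only.  Sequel of K34
(`…TwistedSlabSpectralPurity`): for a spectral trace `Z(t) = Σᵢ μᵢ^t` (`μᵢ ≥ 0`, integer multiplicities) with defect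
`D(t) = 1 − Z(2t)∕Z(t)²`, K34 reads BOTH the excited weight `s_{t*} ≤ δ∕(1−δ)` and the ratio bound `μᵢ∕μ₀ ≤ (δ∕(1−δ))^{1∕t*}` off ONE time.
When the available bound at time `t` has the form `D(t) ≲ C·L·e^{−ct}` (the T1 shape: a prefactor growing with the transverse size `L`), the
one-time rate `−t*⁻¹ log(δ∕(1−δ))` degrades like `1∕log L`.  Reading the RATE off a second, much later time `t₂` instead recovers the full
rate `c` up to any `ε`: `(CLe^{−ct₂})^{1∕t₂} → e^{−c}`.

* ★ `defect_le_of_two_times` — `D(t₁) ≤ δ₁ < 1∕2` and `D(t₂) ≤ δ₂ < 1∕2` ⇒ for all `t ≥ t₁`: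
  `D(t) ≤ 2·(δ₁∕(1−δ₁))·ρ₂^{t−t₁}`, `ρ₂ = (δ₂∕(1−δ₂))^{1∕t₂}` (and `0 ≤ ρ₂ < 1`).

HONEST FRAMING: elementary; by itself nothing about `β`, `L`, T1, `IRcof`, `IR` or the Yang–Mills mass gap (Clay: NOT proved); R4 = `BalabanLadder.UV` only.
-/

set_option autoImplicit false

noncomputable section

open Filter Topology Real

namespace Summit.QuantumFields.YangMills.Cruxes.IRcof.TwistedSlab

namespace SpectralPurity

variable {ι : Type*} {μ : ι → ℝ} {Z : ℕ → ℝ} {t₀ : ℕ}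

/-- ★ **PURITY PROPAGATION FROM TWO TIMES.**  Let `μᵢ ≥ 0` with `Σᵢ μᵢ^t = Z(t)` for `t ≥ t₀`, and let `t₁, t₂ ≥ max(t₀,1)` with `0 < Z(t₁)`,
`1 − Z(2t₁)∕Z(t₁)² ≤ δ₁ < 1∕2`, `1 − Z(2t₂)∕Z(t₂)² ≤ δ₂`, `0 ≤ δ₂ < 1∕2`.  Then `ρ₂ := (δ₂∕(1−δ₂))^{1∕t₂} ∈ [0,1)` and for every `t ≥ t₁`:
`1 − Z(2t)∕Z(t)² ≤ 2·(δ₁∕(1−δ₁))·ρ₂^{t−t₁}` — the excited weight is read at `t₁`, every eigenvalue ratio at `t₂` (integer multiplicities: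
`(μᵢ∕μ₀)^{t₂} ≤ s_{t₂} ≤ δ₂∕(1−δ₂)`). [folklore] -/
theorem defect_le_of_two_times (hμ : ∀ i, 0 ≤ μ i) (hZ : ∀ t, t₀ ≤ t → HasSum (fun i => μ i ^ t) (Z t))
    {t₁ t₂ : ℕ} (h₀₁ : t₀ ≤ t₁) (h₁ : 1 ≤ t₁) (h₀₂ : t₀ ≤ t₂) (h₂ : 1 ≤ t₂) (hpos : 0 < Z t₁)
    {δ₁ δ₂ : ℝ} (hδ₁ : δ₁ < 1 / 2) (hδ₂0 : 0 ≤ δ₂) (hδ₂ : δ₂ < 1 / 2)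
    (hD₁ : 1 - Z (2 * t₁) / Z t₁ ^ 2 ≤ δ₁) (hD₂ : 1 - Z (2 * t₂) / Z t₂ ^ 2 ≤ δ₂) :
    0 ≤ (δ₂ / (1 - δ₂)) ^ (1 / (t₂ : ℝ)) ∧ (δ₂ / (1 - δ₂)) ^ (1 / (t₂ : ℝ)) < 1 ∧
      ∀ t, t₁ ≤ t → 1 - Z (2 * t) / Z t ^ 2 ≤ 2 * (δ₁ / (1 - δ₁)) * ((δ₂ / (1 - δ₂)) ^ (1 / (t₂ : ℝ))) ^ (t - t₁) := by
  classical
  set S₁ : ℝ := δ₁ / (1 - δ₁) with hS₁def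
  set S₂ : ℝ := δ₂ / (1 - δ₂) with hS₂def
  set ρ : ℝ := S₂ ^ (1 / (t₂ : ℝ)) with hρdef
  have h1δ₁ : 0 < 1 - δ₁ := by linarith
  have h1δ₂ : 0 < 1 - δ₂ := by linarith
  have hS₂0 : 0 ≤ S₂ := div_nonneg hδ₂0 h1δ₂.le
  have hS₂1 : S₂ < 1 := by rw [hS₂def, div_lt_one h1δ₂]; linarith
  have ht₂0 : (0 : ℝ) < t₂ := by exact_mod_cast h₂
  have hρ0 : 0 ≤ ρ := Real.rpow_nonneg hS₂0 _
  have hρ1 : ρ < 1 := Real.rpow_lt_one hS₂0 hS₂1 (by positivity)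
  refine ⟨hρ0, hρ1, fun t ht => ?_⟩
  -- the top eigenvalue (read at `t₁`)
  obtain ⟨i₀, h0, hmax⟩ := exists_isMax_of_hasSum_pow hμ h₁ (hZ t₁ h₀₁) hpos
  have hZt := hZ t (h₀₁.trans ht)
  have hZ2t := hZ (2 * t) ((h₀₁.trans ht).trans (by omega))
  have hZ1 := hZ t₁ h₀₁
  have hZ21 := hZ (2 * t₁) (h₀₁.trans (by omega))
  have hZ2 := hZ t₂ h₀₂
  have hZ22 := hZ (2 * t₂) (h₀₂.trans (by omega))
  -- excited weights `s_t ≤ δ/(1−δ)` at `t₁` and at `t₂`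
  have hsS : ∀ {τ : ℕ} {δ : ℝ}, δ < 1 / 2 → HasSum (fun i => μ i ^ τ) (Z τ) → HasSum (fun i => μ i ^ (2 * τ)) (Z (2 * τ)) →
      1 - Z (2 * τ) / Z τ ^ 2 ≤ δ → Z τ / μ i₀ ^ τ - 1 ≤ δ / (1 - δ) := by
    intro τ δ hδ hZτ hZ2τ hD
    have hs0 : 0 ≤ Z τ / μ i₀ ^ τ - 1 := ratioSum_nonneg hμ h0 hZτ
    have hlow := div_le_defect hs0 (ratioSum_two_mul_le hμ h0 hmax hZτ hZ2τ)
    rw [← defect_eq h0 τ] at hlow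
    have h := hlow.trans hD
    set s := Z τ / μ i₀ ^ τ - 1 with hsdef
    have h1s : 0 < 1 + s := by linarith
    have h1δ : 0 < 1 - δ := by linarith
    rw [div_le_iff₀ h1s] at h
    rw [le_div_iff₀ h1δ]
    linarith
  have hs₁ : Z t₁ / μ i₀ ^ t₁ - 1 ≤ S₁ := hsS hδ₁ hZ1 hZ21 hD₁
  have hs₂ : Z t₂ / μ i₀ ^ t₂ - 1 ≤ S₂ := hsS hδ₂ hZ2 hZ22 hD₂
  -- every non-top ratio is `≤ ρ` (read at `t₂`)
  have hrat : ∀ i, i ≠ i₀ → μ i / μ i₀ ≤ ρ := fun i hi => by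
    have hri : (μ i / μ i₀) ^ t₂ ≤ S₂ := (ratio_pow_le_ratioSum hμ h0 hZ2 hi).trans hs₂
    have hr0 : 0 ≤ μ i / μ i₀ := div_nonneg (hμ i) h0.le
    calc μ i / μ i₀ = ((μ i / μ i₀) ^ t₂) ^ (1 / (t₂ : ℝ)) := by
          rw [← Real.rpow_natCast, ← Real.rpow_mul hr0, mul_one_div_cancel ht₂0.ne', Real.rpow_one]
      _ ≤ S₂ ^ (1 / (t₂ : ℝ)) := Real.rpow_le_rpow (pow_nonneg hr0 _) hri (by positivity)
  -- `s_t ≤ ρ^{t − t₁} s_{t₁} ≤ ρ^{t−t₁} S₁`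
  have hst : Z t / μ i₀ ^ t - 1 ≤ ρ ^ (t - t₁) * S₁ :=
    (ratioSum_le_pow_mul hμ h0 hrat ht hZ1 hZt).trans (mul_le_mul_of_nonneg_left hs₁ (pow_nonneg hρ0 _))
  have hst0 : 0 ≤ Z t / μ i₀ ^ t - 1 := ratioSum_nonneg hμ h0 hZt
  have hs2t0 : 0 ≤ Z (2 * t) / μ i₀ ^ (2 * t) - 1 := ratioSum_nonneg hμ h0 hZ2t
  rw [defect_eq h0 t]
  refine (defect_le_two_mul hst0 hs2t0).trans ?_
  calc 2 * (Z t / μ i₀ ^ t - 1) ≤ 2 * (ρ ^ (t - t₁) * S₁) := by linarith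
    _ = 2 * (δ₁ / (1 - δ₁)) * ρ ^ (t - t₁) := by rw [hS₁def]; ring

end SpectralPurity

end Summit.QuantumFields.YangMills.Cruxes.IRcof.TwistedSlab

end
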